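import Summits.QuantumFields.YangMills.Theorems.BalabanUVNodesN12BlockChains
import Summits.QuantumFields.YangMills.Theorems.BalabanUVNodesN20LCSAvgDominationRegion
import HarnessLib

/-!
# BalabanUVNodes ∕ N12 — THE BOX-CLOSED FAMILY OF PLAQUETTE SETS AROUND A MEMBER SEGMENT (the geometry displayed by `N12IteratedPlaqLetterOfFamily`): at level `j` the plaquettes whose source,
# read on the fine torus through the centre embedding `ι_j`, lies in the coordinate box of radius `B_{i,j} = 3·Lⁱ + ρ·Σ_{j ≤ l < i} Lˡ` (`ρ = (d+4)L + 2`) around `ι_i c₋` — box-closed downward in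
# dag-n11's sense and containing the three-block plaquettes of every bond of the segment ([Balaban1985Averaging] Prop. 2's footprint; [Balaban1987RG1] (0.1)–(0.3) block geometry)

Cell `pub-ymgap` (HUMAN RULINGS D-0062 ∕ D-0149), WIDTH SEAT `pub-ymgap-dag-n12-w3` g4 (node N12 = [B15]; key K1⁹ `stmt-QuantumFields-27364` (KEY MAP v2), `--kind proof --supports … --as
helper`; count-neutral).  THEOREMS ONLY (0 `def`, 0 `instance`, 0 `sorry`); lattice bookkeeping: the centre embedding on integer offsets (`val_embIter`), the block centre of a site, iterated
shifts, dag-n20's `boxRegion`.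

WHY.  `N12IteratedPlaqLetterOfFamily.iteratedPlaqLetter_of_family` discharges the plaquette letter on the iterated averages from the class MODULO a per-member family `Sfam i c j` of level-`j`
plaquette sets with three clauses: (closed) dag-n11's downward box-closure `boxRegion (emb p₋) ((d+4)L+2) ⊆ Sfam i c j` for `p ∈ Sfam i c (j+1)`, `j < i − 1`; (base) `Sfam i c 0` inside the class
region two levels down; (need) the level-`j` plaquettes of the three blocks around every level-`(j+1)` bond of the segment of `c` belong to `Sfam i c j`.  THIS FILE gives the family and the
clauses (closed) and (need) in pure lattice terms: `Sfam i c j := {q | ∀ ν, ∃ E, |E| ≤ B_{i,j} ∧ (ι_j q₋) ν = (ι_i c₋) ν + E}` — §1 ★ `embIter_apply_of_add` (`ι_l` is affine on integer offsets: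
`ι_l (x + E) = ι_l x + Lˡ·E`, mod the periods), `iterate_shift_apply`, `exists_offset_from_blockCentre` (a site is within `(L−1)∕2` of the centre of its block); §2 ★★ `family_boxClosed`
(`B_{i,j} = B_{i,j+1} + ρ·Lʲ`), ★★ `mem_family_of_threeBlocks` (offset `≤ (Lⁱ − 1) + L^{j+1} + ((L−1)∕2)·Lʲ ≤ 3·Lⁱ`).  The clause (base) and the assembled existence at the record are the next file.

HONEST FRAMING.  Lattice bookkeeping; no analysis; nothing of Bałaban's asserted; count-neutral; N12 NOT discharged; K1⁹ NOT closed; counts unmoved (typed 28∕28 · discharged 5∕27); one finite 𝕋⁴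
programme at fixed ε — R4 closes the conditional rung `BalabanLadder.UV` only; the Yang–Mills mass gap (Clay) is NOT proved by any of this; nothing continuum ∕ ℝ⁴ ∕ OS.
-/

noncomputable section

namespace Summit.QuantumFields.YangMills.BalabanUVNodes.N12SegmentPlaqFamily

open scoped BigOperators
open Literature.MathematicalPhysics.QuantumFieldTheory.Balaban1983to89
open T4Continuum
open B15DeterminingSets
open Summit.QuantumFields.YangMills.Theorems.Prop7FlatHolonomy (sitesPerDir_zero_eq_mul_pow)
open Summit.QuantumFields.YangMills.Theorems.Prop7TentInterpolation (val_embIter)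
open Summit.QuantumFields.YangMills.BalabanUVNodes.N20LCSAvgDominationRegion (boxRegion mem_boxRegion)

variable {P : Params}

/-! ## §1 The centre embedding on integer offsets; iterated shifts; the centre of the block of a site -/

section Algebra

/-- ★ **`ι_l` IS AFFINE ON INTEGER OFFSETS**: if `y = x + E` coordinatewise on `T^{(l)}` (integers `E_ν` read mod the period), then `ι_l y = ι_l x + Lˡ·E` on the fine torus (labels
`n ↦ n·Lˡ + (Lˡ−1)∕2`, `val_embIter`; the periods are `N₀ = N_l·Lˡ`). [cite: Balaban1987RG1, (0.1) p.251 (bookkeeping)] -/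
theorem embIter_apply_of_add {l : ℕ} (hl : l ≤ P.m + P.K) (x y : Site P l) (E : Fin P.d → ℤ)
    (h : ∀ ν, y ν = x ν + ((E ν : ℤ) : ZMod (P.sitesPerDir l))) (ν : Fin P.d) :
    embIter l y ν = embIter l x ν + ((E ν * (P.L ^ l : ℕ) : ℤ) : ZMod (P.sitesPerDir 0)) := by
  have hN : P.sitesPerDir 0 = P.sitesPerDir l * P.L ^ l := sitesPerDir_zero_eq_mul_pow hl
  have hy : (embIter l y ν : ZMod (P.sitesPerDir 0)) = (((y ν).val * P.L ^ l + (P.L ^ l - 1) / 2 : ℕ) : ZMod (P.sitesPerDir 0)) := by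
    rw [← val_embIter hl y ν, ZMod.natCast_zmod_val]
  have hx : (embIter l x ν : ZMod (P.sitesPerDir 0)) = (((x ν).val * P.L ^ l + (P.L ^ l - 1) / 2 : ℕ) : ZMod (P.sitesPerDir 0)) := by
    rw [← val_embIter hl x ν, ZMod.natCast_zmod_val]
  have hmod : (((y ν).val : ℤ) : ZMod (P.sitesPerDir l)) = ((((x ν).val : ℤ) + E ν : ℤ) : ZMod (P.sitesPerDir l)) := by
    push_cast
    rw [ZMod.natCast_zmod_val, ZMod.natCast_zmod_val]
    exact h ν
  rw [ZMod.intCast_eq_intCast_iff_dvd_sub] at hmod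
  have hdvd : ((P.sitesPerDir 0 : ℕ) : ℤ) ∣ ((((x ν).val : ℤ) + E ν) - (y ν).val) * (P.L ^ l : ℕ) := by
    rw [hN, Nat.cast_mul]
    exact mul_dvd_mul_right hmod _
  have hcast : ((((y ν).val : ℤ) * (P.L ^ l : ℕ) : ℤ) : ZMod (P.sitesPerDir 0)) = (((((x ν).val : ℤ) + E ν) * (P.L ^ l : ℕ) : ℤ) : ZMod (P.sitesPerDir 0)) := by
    rw [ZMod.intCast_eq_intCast_iff_dvd_sub]
    have : (((x ν).val : ℤ) + E ν) * (P.L ^ l : ℕ) - ((y ν).val : ℤ) * (P.L ^ l : ℕ) = ((((x ν).val : ℤ) + E ν) - (y ν).val) * (P.L ^ l : ℕ) := by ring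
    rw [this]; exact hdvd
  rw [hy, hx]
  push_cast at hcast ⊢
  rw [hcast]
  ring

/-- An `s`-fold unit shift in direction `μ` adds `s` to the `μ`-coordinate and nothing else. [folklore] -/
theorem iterate_shift_apply {l : ℕ} (μ : Fin P.d) : ∀ (s : ℕ) (x : Site P l) (ν : Fin P.d),
    ((fun z : Site P l => z.shift μ)^[s] x) ν = x ν + if ν = μ then (s : ZMod (P.sitesPerDir l)) else 0
  | 0, x, ν => by simp
  | s + 1, x, ν => by
      rw [Function.iterate_succ_apply', Site.shift_apply, iterate_shift_apply μ s x ν, iterate_shift_apply μ s x μ]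
      by_cases hν : ν = μ
      · subst hν; simp only [if_true]; push_cast; ring
      · simp only [if_neg hν, if_true]

/-- **A SITE IS WITHIN `(L−1)∕2` OF THE CENTRE OF ITS BLOCK**, coordinatewise (labels `n = L·(n∕L) + n % L`, centre label `L·(n∕L) + (L−1)∕2`, `L` odd). [cite: Balaban1987RG1, (0.3) p.252 (bookkeeping)] -/
theorem exists_offset_from_blockCentre {l : ℕ} (hl : l + 1 ≤ P.m + P.K) (y : Site P l) (ν : Fin P.d) :
    ∃ r : ℤ, |r| ≤ (((P.L - 1) / 2 : ℕ) : ℤ) ∧ y ν = (emb (blockOf y)) ν + (r : ZMod (P.sitesPerDir l)) := by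
  have hL := P.L_pos
  have hodd : P.L % 2 = 1 := Nat.odd_iff.mp P.hL.1
  have hval : ((emb (blockOf y)) ν).val = (y ν).val / P.L * P.L + (P.L - 1) / 2 := by
    rw [Site.val_emb hl, Site.val_blockOf hl]
  obtain ⟨a, ha⟩ : ∃ a : ℕ, (y ν).val = a := ⟨_, rfl⟩
  rw [ha] at hval
  refine ⟨((a % P.L : ℕ) : ℤ) - (((P.L - 1) / 2 : ℕ) : ℤ), ?_, ?_⟩
  · have hlt : a % P.L < P.L := Nat.mod_lt _ hL
    rw [abs_le]; constructor <;> omega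
  · have hdm : a = a / P.L * P.L + a % P.L := by rw [mul_comm]; exact (Nat.div_add_mod _ _).symm
    have h1 : (y ν : ZMod (P.sitesPerDir l)) = ((a : ℕ) : ZMod (P.sitesPerDir l)) := by rw [← ha, ZMod.natCast_zmod_val]
    have h2 : ((emb (blockOf y)) ν : ZMod (P.sitesPerDir l)) = (((a / P.L * P.L + (P.L - 1) / 2 : ℕ)) : ZMod (P.sitesPerDir l)) := by
      rw [← hval, ZMod.natCast_zmod_val]
    rw [Int.cast_sub, Int.cast_natCast, Int.cast_natCast, h1, h2]
    conv_lhs => rw [hdm]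
    push_cast
    ring

/-- The block relation as an offset: `c₊ = c₋ + e_dir`, `c₋ − e_dir = c₋ − e_dir` — the three blocks around a bond are integer offsets `0, +1, −1` of its source in the bond's direction. [folklore] -/
theorem exists_offset_of_threeBlocks {l : ℕ} (c' : PBond P l) {w : Site P l} (hw : w = c'.src.unshift c'.dir ∨ w = c'.src ∨ w = c'.tgt) :
    ∃ δ : ℤ, |δ| ≤ 1 ∧ ∀ ν, w ν = c'.src ν + (((if ν = c'.dir then δ else 0 : ℤ)) : ZMod (P.sitesPerDir l)) := by
  rcases hw with rfl | rfl | rfl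
  · refine ⟨-1, by norm_num, fun ν => ?_⟩
    rw [Site.unshift_apply]
    by_cases hν : ν = c'.dir
    · subst hν; simp [sub_eq_add_neg]
    · simp [hν]
  · exact ⟨0, by norm_num, fun ν => by simp⟩
  · refine ⟨1, by norm_num, fun ν => ?_⟩
    show (c'.src.shift c'.dir) ν = _
    rw [Site.shift_apply]
    by_cases hν : ν = c'.dir
    · subst hν; simp
    · simp [hν]

end Algebra

/-! ## §2 The family around a member segment: box-closed, and it contains the three-block plaquettes -/

section Family

/-- ★★ **THE FAMILY IS BOX-CLOSED DOWNWARD** (dag-n11's premise): if `(ι_{j+1} p₋)_ν = (ι_i c₋)_ν + E_ν` with `|E_ν| ≤ B_{i,j+1}` and `q ∈ boxRegion (emb p₋) ρ` at level `j` (`q₋ = emb p₋ + e`, `|e_ν| ≤ ρ`),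
then `(ι_j q₋)_ν = (ι_i c₋)_ν + (E_ν + e_ν·Lʲ)` with `|…| ≤ B_{i,j+1} + ρ·Lʲ = B_{i,j}` (`B_{i,j} = 3·Lⁱ + ρ·Σ_{j≤l<i} Lˡ`, `j < i`). [cite: Balaban1985Averaging, Prop. 2 (52)–(53) p.26 (the footprint); Balaban1987RG1, (0.1) p.251] -/
theorem family_boxClosed {i j : ℕ} (hji : j < i) (hi : i ≤ P.m + P.K) (ρ : ℕ) (x₀ : Site P 0) {p : Plaq P (j + 1)}
    (hp : ∀ ν, ∃ E : ℤ, |E| ≤ ((3 * P.L ^ i + ρ * ∑ l ∈ Finset.Ico (j + 1) i, P.L ^ l : ℕ) : ℤ) ∧ embIter (j + 1) p.src ν = x₀ ν + (E : ZMod (P.sitesPerDir 0)))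
    {q : Plaq P j} (hq : q ∈ boxRegion (emb p.src) ρ) :
    ∀ ν, ∃ E : ℤ, |E| ≤ ((3 * P.L ^ i + ρ * ∑ l ∈ Finset.Ico j i, P.L ^ l : ℕ) : ℤ) ∧ embIter j q.src ν = x₀ ν + (E : ZMod (P.sitesPerDir 0)) := by
  classical
  rw [mem_boxRegion] at hq
  choose e he hqe using hq
  have hsum : ∑ l ∈ Finset.Ico j i, P.L ^ l = P.L ^ j + ∑ l ∈ Finset.Ico (j + 1) i, P.L ^ l := Finset.sum_eq_sum_Ico_succ_bot hji _
  intro ν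
  obtain ⟨E, hE, hpE⟩ := hp ν
  refine ⟨E + e ν * (P.L ^ j : ℕ), ?_, ?_⟩
  · have h1 : |e ν * (P.L ^ j : ℕ)| ≤ (ρ : ℤ) * (P.L ^ j : ℕ) := by
      rw [abs_mul, Nat.abs_cast]
      exact mul_le_mul_of_nonneg_right (he ν) (by positivity)
    have h2 := abs_add_le E (e ν * (P.L ^ j : ℕ))
    have hsum0 : (0 : ℤ) ≤ (ρ : ℤ) * ((∑ l ∈ Finset.Ico (j + 1) i, P.L ^ l : ℕ) : ℤ) := by positivity
    rw [hsum]; push_cast at hE h1 h2 hsum0 ⊢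
    nlinarith [h2, hE, h1, hsum0]
  · have h := embIter_apply_of_add (by omega : j ≤ P.m + P.K) (emb p.src) q.src e hqe ν
    rw [h, show embIter j (emb p.src) = embIter (j + 1) p.src from rfl, hpE]
    push_cast
    ring

/-- ★★ **THE THREE-BLOCK PLAQUETTES BELONG TO THE FAMILY**: for a level-`(j+1)` bond `c′` in direction `dir c` whose source centre sits on the segment (`ι_{j+1} c′₋ = ι_i c₋ + s·e_{dir}`, `s < Lⁱ`,
`j < i`) and a level-`j` plaquette `q` based in the block `c′₋ − e`, `c′₋` or `c′₊`: `(ι_j q₋)_ν = (ι_i c₋)_ν + E_ν` with `|E_ν| ≤ (Lⁱ − 1) + L^{j+1} + ((L−1)∕2)·Lʲ ≤ 3·Lⁱ ≤ B_{i,j}`.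
[cite: Balaban1987RG1, (0.1)–(0.3) pp.251–252 (bookkeeping); Balaban1985Averaging, (26)–(27) p.22] -/
theorem mem_family_of_threeBlocks {i j : ℕ} (hji : j < i) (hi : i ≤ P.m + P.K) (ρ : ℕ) {c : PBond P i} {c' : PBond P (j + 1)} (hdir : c'.dir = c.dir)
    (hs : ∃ s < P.L ^ i, embIter (j + 1) c'.src = (fun z : Site P 0 => z.shift c.dir)^[s] (embIter i c.src))
    {q : Plaq P j} (hq : blockOf q.src = c'.src.unshift c'.dir ∨ blockOf q.src = c'.src ∨ blockOf q.src = c'.tgt) :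
    ∀ ν, ∃ E : ℤ, |E| ≤ ((3 * P.L ^ i + ρ * ∑ l ∈ Finset.Ico j i, P.L ^ l : ℕ) : ℤ) ∧ embIter j q.src ν = embIter i c.src ν + (E : ZMod (P.sitesPerDir 0)) := by
  classical
  obtain ⟨s, hs, hseg⟩ := hs
  obtain ⟨δ, hδ, hw⟩ := exists_offset_of_threeBlocks c' hq
  -- the site in its block: `q₋ = emb (blockOf q₋) + r`
  choose r hr hqr using fun ν => exists_offset_from_blockCentre (by omega : j + 1 ≤ P.m + P.K) q.src ν
  have hLpow : P.L ^ (j + 1) ≤ P.L ^ i := Nat.pow_le_pow_right P.L_pos hji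
  have hLj : ((P.L - 1) / 2) * P.L ^ j ≤ P.L ^ i := by
    have : ((P.L - 1) / 2) * P.L ^ j ≤ P.L * P.L ^ j := Nat.mul_le_mul_right _ (by omega)
    rw [← pow_succ'] at this
    exact this.trans hLpow
  intro ν
  -- `ι_j q₋ = ι_{j+1}(blockOf q₋) + r·Lʲ`
  have h1 := embIter_apply_of_add (by omega : j ≤ P.m + P.K) (emb (blockOf q.src)) q.src r hqr ν
  rw [show embIter j (emb (blockOf q.src)) = embIter (j + 1) (blockOf q.src) from rfl] at h1
  -- `ι_{j+1}(blockOf q₋) = ι_{j+1} c′₋ + δ·[ν = dir]·L^{j+1}`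
  have h2 := embIter_apply_of_add (by omega : j + 1 ≤ P.m + P.K) c'.src (blockOf q.src) (fun ν => if ν = c'.dir then δ else 0) hw ν
  -- `ι_{j+1} c′₋ = ι_i c₋ + s·[ν = dir]`
  have h3 : embIter (j + 1) c'.src ν = embIter i c.src ν + if ν = c.dir then (s : ZMod (P.sitesPerDir 0)) else 0 := by
    rw [hseg]; exact iterate_shift_apply c.dir s _ ν
  refine ⟨(if ν = c.dir then (s : ℤ) + δ * (P.L ^ (j + 1) : ℕ) else 0) + r ν * (P.L ^ j : ℕ), ?_, ?_⟩
  · -- the size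
    have hr' : |r ν * (P.L ^ j : ℕ)| ≤ (((P.L - 1) / 2 : ℕ) : ℤ) * (P.L ^ j : ℕ) := by
      rw [abs_mul, Nat.abs_cast]; exact mul_le_mul_of_nonneg_right (hr ν) (by positivity)
    have hA : |(if ν = c.dir then (s : ℤ) + δ * (P.L ^ (j + 1) : ℕ) else 0)| ≤ ((P.L ^ i : ℕ) : ℤ) + (P.L ^ (j + 1) : ℕ) := by
      split_ifs
      · have hδ' : |δ * (P.L ^ (j + 1) : ℕ)| ≤ 1 * (P.L ^ (j + 1) : ℕ) := by
          rw [abs_mul, Nat.abs_cast]; exact mul_le_mul_of_nonneg_right hδ (by positivity)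
        have := abs_add_le (s : ℤ) (δ * (P.L ^ (j + 1) : ℕ))
        rw [Nat.abs_cast] at this
        have hs' : (s : ℤ) ≤ (P.L ^ i : ℕ) := by exact_mod_cast hs.le
        linarith
      · simp only [abs_zero]; positivity
    have h := abs_add_le (if ν = c.dir then (s : ℤ) + δ * (P.L ^ (j + 1) : ℕ) else 0) (r ν * (P.L ^ j : ℕ))
    have hLpow' : ((P.L ^ (j + 1) : ℕ) : ℤ) ≤ (P.L ^ i : ℕ) := by exact_mod_cast hLpow
    have hLj' : ((((P.L - 1) / 2 : ℕ) : ℤ)) * (P.L ^ j : ℕ) ≤ (P.L ^ i : ℕ) := by exact_mod_cast hLj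
    have hsum0 : (0 : ℤ) ≤ (ρ : ℤ) * ((∑ l ∈ Finset.Ico j i, P.L ^ l : ℕ) : ℤ) := by positivity
    push_cast at hr' hA h hLpow' hLj' hsum0 ⊢
    nlinarith [hr', hA, h, hLpow', hLj', hsum0]
  · -- the identity
    rw [h1, h2, h3, hdir]
    by_cases hν : ν = c.dir
    · subst hν; simp only [if_true]; push_cast; ring
    · simp only [if_neg hν]; push_cast; ring

end Family

end Summit.QuantumFields.YangMills.BalabanUVNodes.N12SegmentPlaqFamily

end
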